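import Literature.MathematicalPhysics.QuantumLattice.HubbardNNNHoppingWindowCertificateD4

/-!
# PACKED-LETTER BRIDGE for the symreplay checker (checklist L3 item (b); hub-lb-sym-eng-1 g1, 2026-08-28)

Part A core of `Cruxes/LowerEdge_ge_m83o100/Lines/symreplay.lean` (rev 8, `section Syntax` l.107–194:
letters / words / `insL` / `nfWord` / `nfPoly`) copied VERBATIM, sym-ref-1's PACKED twin
(`pub/hub-lb/hub-lb-sym-ref-1/engine/H_base.lean` (b): a letter is ONE natural number
`2·mode + (1 − dag)`, `pinsL` / `pnfWord` / `pnfPoly`) copied VERBATIM, and the BRIDGE THEOREMS that make the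
packed pipeline SOUND by reduction to the structured one:

* `enc R : Letter → ℕ` (box encoding of radius `R`: `mode = ((x₀+R)(2R+1) + (x₁+R))·2 + s`), `InBox R`;
* `pmodeEq_enc` / `pmodeLt_enc` / `pdag_enc`: the packed comparisons ARE the structured ones on in-box letters;
* `pinsL_enc : pinsL (enc R ℓ) (u.map (enc R)) = (insL ℓ u).map (encT R)`;
* `pnfWord_enc : pnfWord (w.map (enc R)) = (nfWord w).map (encT R)`;  `pnfPoly_enc`;
* `pevalP_encP : pevalP g (p.map (encT R)) = evalP (g ∘ map (enc R)) p` — so any packed-side evaluation /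
  zero test transfers to the structured polynomial, and S1 (`NfFaithful`) is reused unchanged.

No `sorry`; axioms standard.  Measurement motive (sym-ref-1 l.850/l.882, crit-1 V57/V62): packed letters run the
identity check ≈ ×5 faster end-to-end (1.3–1.7×10⁴ products/s), which puts the v0′ replay inside one farm call.
HONEST FRAMING: a syntactic lemma about two list programs; no bound, no certificate; nothing here predicts
superconductivity; no summit or crux statement is proved here.
-/

namespace HubLbSymEng1.PackBridge

open Literature.Probability.LatticeModels (Site)

section Syntax

/-- Boolean equality of sites of `ℤ²` (coordinatewise; the checker never calls the `Fintype`-based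
`DecidableEq (Fin 2 → ℤ)`). -/
def siteEq (x y : Site 2) : Bool := x 0 == y 0 && x 1 == y 1

/-- Lexicographic comparison of sites. -/
def siteLt (x y : Site 2) : Bool := decide (x 0 < y 0) || (x 0 == y 0 && decide (x 1 < y 1))

/-- A raw ladder letter: site, spin (`0 = ↑`, `1 = ↓`), dagger flag (`true` = creation `c†`). -/
structure Letter where
  x : Site 2
  s : Fin 2
  dag : Bool

/-- Same orbital `(x, σ)`. -/
def Letter.modeEq (a b : Letter) : Bool := siteEq a.x b.x && a.s == b.s

/-- Mode order: site lexicographic, then spin. -/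
def Letter.modeLt (a b : Letter) : Bool := siteLt a.x b.x || (siteEq a.x b.x && decide (a.s.val < b.s.val))

/-- Equality of letters. -/
def Letter.beq (a b : Letter) : Bool := a.modeEq b && a.dag == b.dag

/-- Letter order (creators before annihilators of the same mode). -/
def Letter.blt (a b : Letter) : Bool := a.modeLt b || (a.modeEq b && a.dag && !b.dag)

/-- The adjoint letter. -/
def Letter.adj (a : Letter) : Letter := ⟨a.x, a.s, !a.dag⟩

/-- `c†_{xσ}`. -/
def cre (x : Site 2) (σ : Fin 2) : Letter := ⟨x, σ, true⟩

/-- `c_{xσ}`. -/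
def ann (x : Site 2) (σ : Fin 2) : Letter := ⟨x, σ, false⟩

/-- A word `ℓ₁ ⋯ ℓ_k` (product in list order). -/
abbrev Word := List Letter

/-- A formal `ℚ`-linear combination of words (unnormalised association list; its meaning is the sum). -/
abbrev QPoly := List (ℚ × Word)

/-- Equality of words. -/
def wordEq : Word → Word → Bool
  | [], [] => true
  | a :: u, b :: v => a.beq b && wordEq u v
  | _, _ => false

/-- Lexicographic order of words (shorter prefix first). -/
def wordLt : Word → Word → Bool
  | [], [] => false
  | [], _ :: _ => true
  | _ :: _, [] => false
  | a :: u, b :: v => a.blt b || (a.beq b && wordLt u v)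

/-- Prefix the letter `m` to every word, flipping the sign of every coefficient. -/
def consNeg (m : Letter) (p : QPoly) : QPoly := p.map fun t => (-t.1, m :: t.2)

/-- **The CAR normal-ordering kernel.**  Left-multiply the (normal-ordered) word `u` by the letter `ℓ`:
creators are inserted into the sorted creator block with a sign per transposition (`c†c† = −c†c†`,
`(c†)² = 0`), annihilators are moved right through the creators by `c_i c†_j = δ_ij − c†_j c_i` and then
inserted into the sorted annihilator block.  Structural recursion on `u`. -/
def insL (ℓ : Letter) : Word → QPoly
  | [] => [(1, [ℓ])]
  | m :: rest =>
    if ℓ.dag then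
      if m.dag then
        if ℓ.modeEq m then [] else if ℓ.modeLt m then [(1, ℓ :: m :: rest)] else consNeg m (insL ℓ rest)
      else [(1, ℓ :: m :: rest)]
    else
      if m.dag then
        (if ℓ.modeEq m then [((1 : ℚ), rest)] else []) ++ consNeg m (insL ℓ rest)
      else
        if ℓ.modeEq m then [] else if ℓ.modeLt m then [(1, ℓ :: m :: rest)] else consNeg m (insL ℓ rest)

/-- Normal form of a word: a signed sum of normal-ordered words (creators first, each block sorted). -/
def nfWord : Word → QPoly
  | [] => [(1, [])]
  | ℓ :: w => (nfWord w).flatMap fun t => (insL ℓ t.2).map fun t' => (t.1 * t'.1, t'.2)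

/-- Scalar multiple. -/
def pscale (q : ℚ) (p : QPoly) : QPoly := p.map fun t => (q * t.1, t.2)

/-- Difference `p − r` (unnormalised). -/
def psub (p r : QPoly) : QPoly := p ++ pscale (-1) r

/-- Normal form of a polynomial (termwise `nfWord`, unnormalised). -/
def nfPoly (p : QPoly) : QPoly := p.flatMap fun t => pscale t.1 (nfWord t.2)


/-! ### (b) PACKED-LETTER TWIN (sym-ref-1 `H_base.lean`, VERBATIM): a letter is ONE natural number
`2·mode + (1 − dag)`, so `Letter.blt` = `<` on `ℕ`, `modeEq` = equal halves. -/

abbrev PWord := List ℕ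
abbrev PPoly := List (ℚ × PWord)

@[inline] def pdag (a : ℕ) : Bool := a % 2 == 0
@[inline] def pmodeEq (a b : ℕ) : Bool := a / 2 == b / 2
@[inline] def pmodeLt (a b : ℕ) : Bool := decide (a / 2 < b / 2)

def pconsNeg (m : ℕ) (p : PPoly) : PPoly := p.map fun t => (-t.1, m :: t.2)

/-- `insL` verbatim with packed comparisons. -/
def pinsL (ℓ : ℕ) : PWord → PPoly
  | [] => [(1, [ℓ])]
  | m :: rest =>
    if pdag ℓ then
      if pdag m then
        if pmodeEq ℓ m then [] else if pmodeLt ℓ m then [(1, ℓ :: m :: rest)] else pconsNeg m (pinsL ℓ rest)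
      else [(1, ℓ :: m :: rest)]
    else
      if pdag m then
        (if pmodeEq ℓ m then [((1 : ℚ), rest)] else []) ++ pconsNeg m (pinsL ℓ rest)
      else
        if pmodeEq ℓ m then [] else if pmodeLt ℓ m then [(1, ℓ :: m :: rest)] else pconsNeg m (pinsL ℓ rest)

def pnfWord : PWord → PPoly
  | [] => [(1, [])]
  | ℓ :: w => (pnfWord w).flatMap fun t => (pinsL ℓ t.2).map fun t' => (t.1 * t'.1, t'.2)

def ppscale (q : ℚ) (p : PPoly) : PPoly := p.map fun t => (q * t.1, t.2)
def pnfPoly (p : PPoly) : PPoly := p.flatMap fun t => ppscale t.1 (pnfWord t.2)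

end Syntax

/-! ### The bridge -/

section Bridge

/-- Box mode index (fixed radix, box `[-128, 127]²`): `((x₀+128)·256 + (x₁+128))·2 + s`. -/
def modeIdx (ℓ : Letter) : ℕ := ((ℓ.x 0 + 128).toNat * 256 + (ℓ.x 1 + 128).toNat) * 2 + ℓ.s.val

/-- Packed letter `2·mode + (1 − dag)` (sym-ref-1's coding). -/
def enc (ℓ : Letter) : ℕ := 2 * modeIdx ℓ + (if ℓ.dag then 0 else 1)

/-- Packed term. -/
def encT (t : ℚ × Word) : ℚ × PWord := (t.1, t.2.map enc)

/-- The letter lies in the box `[-128, 127]²` (every frame of the programme does). -/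
def InBox (ℓ : Letter) : Prop := -128 ≤ ℓ.x 0 ∧ ℓ.x 0 ≤ 127 ∧ -128 ≤ ℓ.x 1 ∧ ℓ.x 1 ≤ 127

theorem enc_div_two (ℓ : Letter) : enc ℓ / 2 = modeIdx ℓ := by
  unfold enc; split <;> omega

theorem pdag_enc (ℓ : Letter) : pdag (enc ℓ) = ℓ.dag := by
  unfold pdag enc; cases h : ℓ.dag <;> simp

theorem pmodeEq_enc {a b : Letter} (ha : InBox a) (hb : InBox b) : pmodeEq (enc a) (enc b) = a.modeEq b := by
  obtain ⟨ha0, ha1, ha2, ha3⟩ := ha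
  obtain ⟨hb0, hb1, hb2, hb3⟩ := hb
  have hs : a.s.val < 2 := a.s.isLt
  have ht : b.s.val < 2 := b.s.isLt
  rw [Bool.eq_iff_iff]
  simp only [pmodeEq, enc_div_two, modeIdx, Letter.modeEq, siteEq, beq_iff_eq, Bool.and_eq_true,
    Fin.ext_iff]
  omega

theorem pmodeLt_enc {a b : Letter} (ha : InBox a) (hb : InBox b) : pmodeLt (enc a) (enc b) = a.modeLt b := by
  obtain ⟨ha0, ha1, ha2, ha3⟩ := ha
  obtain ⟨hb0, hb1, hb2, hb3⟩ := hb
  have hs : a.s.val < 2 := a.s.isLt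
  have ht : b.s.val < 2 := b.s.isLt
  rw [Bool.eq_iff_iff]
  simp only [pmodeLt, enc_div_two, modeIdx, Letter.modeLt, siteLt, siteEq, beq_iff_eq, Bool.and_eq_true,
    Bool.or_eq_true, decide_eq_true_eq]
  omega

theorem pconsNeg_map (m : Letter) (p : QPoly) : pconsNeg (enc m) (p.map encT) = (consNeg m p).map encT := by
  simp [pconsNeg, consNeg, encT, List.map_map, Function.comp_def]

/-- **Bridge for the insertion kernel.** -/
theorem pinsL_enc (ℓ : Letter) (hℓ : InBox ℓ) :
    ∀ (u : Word), (∀ m ∈ u, InBox m) → pinsL (enc ℓ) (u.map enc) = (insL ℓ u).map encT := by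
  intro u
  induction u with
  | nil => intro _; simp [pinsL, insL, encT]
  | cons m rest ih =>
    intro hu
    have hm : InBox m := hu m (by simp)
    have hrest : ∀ m' ∈ rest, InBox m' := fun m' h => hu m' (by simp [h])
    have ih' := ih hrest
    simp only [List.map_cons, pinsL, insL, pdag_enc, pmodeEq_enc hℓ hm, pmodeLt_enc hℓ hm]
    split_ifs <;> simp [encT, ih', pconsNeg_map]

theorem insL_letters (ℓ : Letter) : ∀ (u : Word) (t : ℚ × Word), t ∈ insL ℓ u → ∀ x ∈ t.2, x = ℓ ∨ x ∈ u := by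
  intro u
  induction u with
  | nil => intro t ht x hx; simp [insL] at ht; subst ht; simp at hx; exact Or.inl hx
  | cons m rest ih =>
    intro t ht x hx
    have aux : ∀ t' ∈ insL ℓ rest, ∀ y ∈ (m :: t'.2), y = ℓ ∨ y ∈ m :: rest := by
      intro t' ht' y hy
      simp only [List.mem_cons] at hy
      rcases hy with h | h
      · right; simp [h]
      · rcases ih t' ht' y h with h' | h'
        · left; exact h'
        · right; simp [h']
    have single : t = (1, ℓ :: m :: rest) → x = ℓ ∨ x ∈ m :: rest := by
      rintro rfl
      simp only [List.mem_cons] at hx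
      rcases hx with h | h | h
      · exact Or.inl h
      · exact Or.inr (by simp [h])
      · exact Or.inr (by simp [h])
    have mapped : (∃ a, a ∈ insL ℓ rest ∧ (-a.1, m :: a.2) = t) → x = ℓ ∨ x ∈ m :: rest := by
      rintro ⟨t', ht', rfl⟩
      exact aux t' ht' x hx
    have dropped : t = (1, rest) → x = ℓ ∨ x ∈ m :: rest := by
      rintro rfl
      exact Or.inr (List.mem_cons_of_mem m hx)
    simp only [insL] at ht
    split_ifs at ht
    all_goals
      simp only [List.mem_nil_iff, List.mem_singleton, List.mem_append, consNeg, List.mem_map,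
        false_or] at ht
    all_goals
      first
      | exact single ht
      | exact mapped ht
      | exact ht.elim dropped mapped

theorem nfWord_letters : ∀ (w : Word) (t : ℚ × Word), t ∈ nfWord w → ∀ x ∈ t.2, x ∈ w := by
  intro w
  induction w with
  | nil => intro t ht x hx; simp [nfWord] at ht; subst ht; simp at hx
  | cons ℓ w ih =>
    intro t ht x hx
    simp only [nfWord, List.mem_flatMap, List.mem_map] at ht
    obtain ⟨t₀, ht₀, t₁, ht₁, rfl⟩ := ht
    simp only at hx
    rcases insL_letters ℓ t₀.2 t₁ ht₁ x hx with h | h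
    · simp [h]
    · exact List.mem_cons_of_mem _ (ih t₀ ht₀ x h)

theorem flatMap_congr_mem {α β : Type*} (l : List α) (f g : α → List β) (h : ∀ x ∈ l, f x = g x) :
    l.flatMap f = l.flatMap g := by
  induction l with
  | nil => rfl
  | cons a l ih =>
    simp only [List.flatMap_cons]
    rw [h a (by simp), ih (fun x hx => h x (by simp [hx]))]

/-- **Bridge for the normal form.** -/
theorem pnfWord_enc : ∀ (w : Word), (∀ m ∈ w, InBox m) → pnfWord (w.map enc) = (nfWord w).map encT := by
  intro w
  induction w with
  | nil => intro _; simp [pnfWord, nfWord, encT]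
  | cons ℓ w ih =>
    intro hw
    have hℓ : InBox ℓ := hw ℓ (by simp)
    have hw' : ∀ m ∈ w, InBox m := fun m h => hw m (by simp [h])
    simp only [List.map_cons, pnfWord, nfWord, ih hw', List.flatMap_map, List.map_flatMap]
    apply flatMap_congr_mem
    intro t ht
    have hlet : ∀ m ∈ t.2, InBox m := fun m hm => hw' m (nfWord_letters w t ht m hm)
    simp only [Function.comp_def, encT, pinsL_enc ℓ hℓ t.2 hlet, List.map_map]

/-- Bridge for `nfPoly`. -/
theorem pnfPoly_enc (p : QPoly) (hp : ∀ t ∈ p, ∀ m ∈ t.2, InBox m) :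
    pnfPoly (p.map encT) = (nfPoly p).map encT := by
  induction p with
  | nil => rfl
  | cons t p ih =>
    have ht : ∀ m ∈ t.2, InBox m := hp t (by simp)
    have hp' : ∀ t' ∈ p, ∀ m ∈ t'.2, InBox m := fun t' h => hp t' (by simp [h])
    simp only [List.map_cons, pnfPoly, nfPoly, List.flatMap_cons, List.map_append] at ih ⊢
    rw [← ih hp']
    simp [encT, pnfWord_enc t.2 ht, ppscale, pscale, List.map_map, Function.comp_def]

/-! #### Semantics transfer -/

variable {M : Type*} [AddCommGroup M] [Module ℂ M]

/-- Structured evaluation (as in sym-ref-1's `Collect2Sound.evalP`). -/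
def evalP (f : Word → M) (p : QPoly) : M := (p.map fun t => ((t.1 : ℚ) : ℂ) • f t.2).sum

/-- Packed evaluation (as in `PCollect2Sound.pevalP`). -/
def pevalP (g : PWord → M) (p : PPoly) : M := (p.map fun t => ((t.1 : ℚ) : ℂ) • g t.2).sum

theorem pevalP_map_encT (g : PWord → M) (p : QPoly) :
    pevalP g (p.map encT) = evalP (fun w => g (w.map enc)) p := by
  simp [pevalP, evalP, encT, List.map_map, Function.comp_def]

/-- **Soundness transfer.** A packed-side zero of the packed normal form of an encoded polynomial is a
structured-side zero of `nfPoly` under the pulled-back semantics `g ∘ map enc`; with that equal to `wordOp` on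
in-box words, S1 (`NfFaithful`) finishes exactly as for the structured checker. -/
theorem evalP_nfPoly_of_packed (g : PWord → M) (p : QPoly) (hp : ∀ t ∈ p, ∀ m ∈ t.2, InBox m)
    (h0 : pevalP g (pnfPoly (p.map encT)) = 0) :
    evalP (fun w => g (w.map enc)) (nfPoly p) = 0 := by
  rw [pnfPoly_enc p hp, pevalP_map_encT] at h0
  exact h0

/-! #### Decoding, and the turnkey form of the transfer -/

/-- Decode a packed letter (inverse of `enc` on the box). -/
def dec (n : ℕ) : Letter :=
  ⟨![((n / 2 / 2 / 256 : ℕ) : ℤ) - 128, ((n / 2 / 2 % 256 : ℕ) : ℤ) - 128], ⟨n / 2 % 2, Nat.mod_lt _ (by decide)⟩,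
    n % 2 == 0⟩

theorem dec_enc {ℓ : Letter} (h : InBox ℓ) : dec (enc ℓ) = ℓ := by
  obtain ⟨h0, h1, h2, h3⟩ := h
  have hs : ℓ.s.val < 2 := ℓ.s.isLt
  cases ℓ with
  | mk x s d =>
    simp only at h0 h1 h2 h3 hs
    have hd : (enc ⟨x, s, d⟩ % 2 == 0) = d := by
      unfold enc; cases d <;> simp
    have hm : enc ⟨x, s, d⟩ / 2 = modeIdx ⟨x, s, d⟩ := enc_div_two _
    simp only [dec, Letter.mk.injEq]
    refine ⟨?_, ?_, hd⟩
    · funext i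
      fin_cases i
      · simp only [Fin.zero_eta, Fin.isValue, Matrix.cons_val_zero, hm, modeIdx]; omega
      · simp only [Fin.mk_one, Fin.isValue, Matrix.cons_val_one, Matrix.cons_val_fin_one, hm, modeIdx]; omega
    · apply Fin.ext
      simp only [hm, modeIdx]
      omega

theorem map_dec_map_enc (w : Word) (hw : ∀ m ∈ w, InBox m) : (w.map enc).map dec = w := by
  rw [List.map_map]
  conv_rhs => rw [← List.map_id w]
  apply List.map_congr_left
  intro m hm
  simp [dec_enc (hw m hm)]

theorem nfPoly_letters (p : QPoly) : ∀ t ∈ nfPoly p, ∀ x ∈ t.2, ∃ t₀ ∈ p, x ∈ t₀.2 := by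
  intro t ht x hx
  simp only [nfPoly, List.mem_flatMap, pscale, List.mem_map] at ht
  obtain ⟨t₀, ht₀, t₁, ht₁, rfl⟩ := ht
  exact ⟨t₀, ht₀, nfWord_letters t₀.2 t₁ ht₁ x hx⟩

theorem evalP_congr_mem (f f' : Word → M) (p : QPoly) (h : ∀ t ∈ p, f t.2 = f' t.2) :
    evalP f p = evalP f' p := by
  unfold evalP
  congr 1
  apply List.map_congr_left
  intro t ht
  rw [h t ht]

/-- **Turnkey transfer.** For ANY structured word semantics `f` (e.g. `wordOp Λ'`) and an in-box input `p`:
if the PACKED pipeline, run with the decoded semantics `f ∘ map dec`, evaluates the packed normal form to `0`,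
then the structured normal form evaluates to `0` under `f`.  (Feed `h0` from sym-ref-1's `pisZero2_sound`
/ `pcollect2_eval` on the packed collector.) -/
theorem evalP_nfPoly_eq_zero_of_packed (f : Word → M) (p : QPoly) (hp : ∀ t ∈ p, ∀ m ∈ t.2, InBox m)
    (h0 : pevalP (fun pw => f (pw.map dec)) (pnfPoly (p.map encT)) = 0) :
    evalP f (nfPoly p) = 0 := by
  have h1 := evalP_nfPoly_of_packed (fun pw => f (pw.map dec)) p hp h0
  rw [evalP_congr_mem _ f] at h1
  · exact h1
  · intro t ht
    have hl : ∀ m ∈ t.2, InBox m := by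
      intro m hm
      obtain ⟨t₀, ht₀, hm₀⟩ := nfPoly_letters p t ht m hm
      exact hp t₀ ht₀ m hm₀
    simp only [map_dec_map_enc t.2 hl]

end Bridge

/-! ### Kernel sanity demos -/

example : pnfWord ([ann 0 0, cre 0 0].map enc) = (nfWord [ann 0 0, cre 0 0]).map encT := by decide +kernel
example : pnfWord ([cre 0 1, ann ![1, 0] 0, cre ![1, 0] 0, ann 0 1, cre 0 0].map enc)
    = (nfWord [cre 0 1, ann ![1, 0] 0, cre ![1, 0] 0, ann 0 1, cre 0 0]).map encT := by decide +kernel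

example : wordEq (([cre 0 1, ann ![-3, 7] 0].map enc).map dec) [cre 0 1, ann ![-3, 7] 0] = true := by
  decide +kernel

end HubLbSymEng1.PackBridge
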